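import Summits.KontsevichZagierPeriods.KontsevichZagierPeriods.Theorems.RootDecompRationalCubeDichotomyRankDescentP05

/-! # `RootDecompRationalCubeDichotomyRankDescentP06` — part 6/14 of the mechanical ≤400-line split of `RankDescent_v12_landing.lean` (sha256 00885b8b9882f02e…)
Source: decomp-kz lens-2 g13 `RankDescent_v12.lean` (HOME/decomp-kz-lens-2/g13/, sha256 00885b8b…; critic g5-18…g5-66 CLEARED as NODE v1–v12 for crux stmt-KontsevichZagierPeriods-26322 RationalCubePiKernelSingle: rank dichotomy single_of_fullRankGeTwo + RankLeOneKernel, de Rham-exact descent, linear-in-one-variable / hyperbola / Fermat–hyperbolic / conic classes, transport kit, Brieskorn module; writer g7 l.1222: «landing split §0–4 ∣ … ∣ §16 --supports 26322 endorsed»); `#print axioms` pins removed; landed by census-1 g9.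
Split by census-1 g9 `gen/splitlean.py`: scopes re-opened with their `open`/`variable`/`set_option` context; mathematics and declaration order unchanged. -/

noncomputable section
open MeasureTheory Set MvPolynomial
open Literature.NumberTheory.Transcendental
open Literature.NumberTheory.Transcendental.KZ
namespace Summit.KontsevichZagierPeriods.RootDecompRationalCubeDichotomy.Rung26322.RankDescent
variable {M : ℕ}

open MeasureTheory Set MvPolynomial in
open Literature.NumberTheory.Transcendental in
open Literature.NumberTheory.Transcendental.KZ in
/-- `∂_k`-antiderivatives exist in `ℚ[x]`. [folklore] -/
private theorem exists_pderiv_eq (k : Fin M) (P : MvPolynomial (Fin M) ℚ) :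
    ∃ G : MvPolynomial (Fin M) ℚ, pderiv k G = P := by
  have hv : (Pi.single k (1:ℚ) : Fin M → ℚ) ≠ 0 := by
    intro h
    have := congrFun h k
    simp at this
  obtain ⟨G, hG⟩ := exists_dirD_eq (Pi.single k (1:ℚ)) hv P
  refine ⟨G, ?_⟩
  have hs : (∑ j, (Pi.single k (1:ℚ) : Fin M → ℚ) j • (pderiv j G : MvPolynomial (Fin M) ℚ)) = pderiv k G := by
    rw [Finset.sum_eq_single k (fun j _ hj => by simp [hj])
      (fun h => (h (Finset.mem_univ k)).elim)]
    simp
  rw [dirD_apply, hs] at hG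
  exact hG

/-! ## §8 (v4) HYPERBOLA denominators `Q = q₀ + x·y` — the alternating-diagonal functional

For `Q = q₀ + xy` (`q₀ ∈ ℚ`; zero-free on `[0,1]²` iff `q₀ > 0` or `q₀ < −1`) the residue/Gysin computation of the
INSTRUMENT remark gives `H²_dR(𝔸² ∖ Q) = ℚ·[dx∧dy/Q]` with the functional
`diagAlt_{q₀}(P) = Σ_i p_ii (−q₀)^i` (`P = Σ p_ij x^i y^j`); `q₀ = 1` is the census-central denominator `1 + xy`
(`∫∫ 1/(1+xy) = π²/12`), functional = the ALTERNATING DIAGONAL SUM `Σ_i (−1)^i p_ii`. This section proves the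
CONSTRUCTIVE half, kernel-checked: `diagAlt_{q₀}(P) = 0 ⟹ P/Q exact` (with `s = 0` potentials), hence DECIDED (N = 0):
the `s = 0`-exact numerators form a `ℚ`-submodule `Ex0 Q` containing `Q·R` (`G_x = ΦQ`, `∂_xΦ = R`), `x^c`, `y^c`
(`c ≥ 1`: `c·x^c·Q = S_x(x^{c+1}) + S_y(−x^c y)`) hence every off-diagonal monomial, and `u^i − (−q₀)^i`
(`u = xy`, a multiple of `Q`); so `P ≡ diagAlt_{q₀}(P)·1 (mod Ex0 Q)` for every `P`. The residual on this `Q` is the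
ONE-parameter family `diagAlt_{q₀}(P) ≠ 0` (value `= diagAlt·∫∫dxdy/(q₀+xy) +` weight ≤ 1; for `q₀ = 1` a non-zero
rational multiple of `π²` plus Baker-type terms — its vanishing is excluded only by Schanuel-type input). -/

/-- `exS` is `ℚ`-linear in the potential. [folklore] -/
theorem exS_smul {m : ℕ} (Q : MvPolynomial (Fin m) ℚ) (k : Fin m) (c : ℚ) (g : MvPolynomial (Fin m) ℚ) :
    exS Q k (c • g) = c • exS Q k g := by
  simp only [exS, smul_eq_C_mul, Derivation.leibniz, pderiv_C, smul_eq_mul, mul_zero, add_zero]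
  ring

/-- The numerators `P` with `P/Q` exact with `s = 0` potentials, as a `ℚ`-submodule. [folklore] -/
def Ex0 (Q : MvPolynomial (Fin 2) ℚ) : Submodule ℚ (MvPolynomial (Fin 2) ℚ) where
  carrier := {P | ∃ G : Fin 2 → MvPolynomial (Fin 2) ℚ, P * Q = ∑ k, exS Q k (G k)}
  zero_mem' := ⟨0, by simp [exS_zero]⟩
  add_mem' := by
    rintro a b ⟨G, hG⟩ ⟨G', hG'⟩
    refine ⟨G + G', ?_⟩
    rw [add_mul, hG, hG', ← Finset.sum_add_distrib]
    simp only [Pi.add_apply, exS_add]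
  smul_mem' := by
    rintro c a ⟨G, hG⟩
    refine ⟨c • G, ?_⟩
    rw [smul_mul_assoc, hG, Finset.smul_sum]
    simp only [Pi.smul_apply, exS_smul]

/-- Auxiliary step `mem_ex0_iff` (§8): mem ex0 iff. [bookkeeping] -/
theorem mem_ex0_iff {Q P : MvPolynomial (Fin 2) ℚ} :
    P ∈ Ex0 Q ↔ ∃ G : Fin 2 → MvPolynomial (Fin 2) ℚ, P * Q = ∑ k, exS Q k (G k) := Iff.rfl

/-- `Ex0`-members are de Rham-exact (`s = 0`). [folklore] -/
theorem drExact_of_ex0 {Q P : MvPolynomial (Fin 2) ℚ} (h : P ∈ Ex0 Q) : DRExact P Q := by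
  obtain ⟨G, hG⟩ := mem_ex0_iff.mp h
  refine ⟨0, G, ?_⟩
  rw [sum_exS_eq, ← hG, zero_add, pow_one]

/-- Multiples of the denominator are exact: `Q·R/Q = R = ∂_x Φ`. [folklore] -/
theorem mul_mem_ex0 (Q R : MvPolynomial (Fin 2) ℚ) : Q * R ∈ Ex0 Q := by
  obtain ⟨Φ, hΦ⟩ := exists_pderiv_eq (0 : Fin 2) R
  refine mem_ex0_iff.mpr ⟨(Pi.single 0 (Φ * Q) : Fin 2 → MvPolynomial (Fin 2) ℚ), ?_⟩
  rw [sum_exS_single]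
  simp only [exS, Derivation.leibniz, smul_eq_mul, hΦ, Nat.cast_zero, zero_add, map_one, one_mul]
  ring

/-- `q₀ + x·y`. [folklore] -/
def hypQ (q₀ : ℚ) : MvPolynomial (Fin 2) ℚ := C q₀ + X 0 * X 1

/-- `c·x^c ∈ Ex0` with potentials `(x^{c+1}, −x^c y)`. [folklore] -/
theorem natSmul_X0_pow_mem (q₀ : ℚ) (c : ℕ) :
    ((c : ℚ) • X 0 ^ c : MvPolynomial (Fin 2) ℚ) ∈ Ex0 (hypQ q₀) := by
  refine mem_ex0_iff.mpr ⟨![X 0 ^ (c + 1), -(X 0 ^ c * X 1)], ?_⟩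
  simp only [Fin.sum_univ_two, Matrix.cons_val_zero, Matrix.cons_val_one, exS, hypQ, map_add,
    pderiv_C, map_neg, Derivation.leibniz, Derivation.leibniz_pow, smul_eq_mul, pderiv_X_self,
    pderiv_one_X_zero, pderiv_zero_X_one, nsmul_eq_mul, Nat.cast_zero, zero_add, map_one, one_mul, mul_one,
    mul_zero, add_zero, smul_eq_C_mul, Nat.cast_add, Nat.cast_one, map_natCast, Nat.add_sub_cancel]
  ring

/-- `c·y^c ∈ Ex0` with potentials `(−y^c x, y^{c+1})`. [folklore] -/
theorem natSmul_X1_pow_mem (q₀ : ℚ) (c : ℕ) :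
    ((c : ℚ) • X 1 ^ c : MvPolynomial (Fin 2) ℚ) ∈ Ex0 (hypQ q₀) := by
  refine mem_ex0_iff.mpr ⟨![-(X 1 ^ c * X 0), X 1 ^ (c + 1)], ?_⟩
  simp only [Fin.sum_univ_two, Matrix.cons_val_zero, Matrix.cons_val_one, exS, hypQ, map_add,
    pderiv_C, map_neg, Derivation.leibniz, Derivation.leibniz_pow, smul_eq_mul, pderiv_X_self,
    pderiv_one_X_zero, pderiv_zero_X_one, nsmul_eq_mul, Nat.cast_zero, zero_add, map_one, one_mul, mul_one,
    mul_zero, add_zero, smul_eq_C_mul, Nat.cast_add, Nat.cast_one, map_natCast, Nat.add_sub_cancel]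
  ring

/-- Auxiliary step `X0_pow_mem` (§8): X0 pow mem. [bookkeeping] -/
theorem X0_pow_mem (q₀ : ℚ) {c : ℕ} (hc : c ≠ 0) : (X 0 ^ c : MvPolynomial (Fin 2) ℚ) ∈ Ex0 (hypQ q₀) :=
  (Submodule.smul_mem_iff _ (Nat.cast_ne_zero.mpr hc)).mp (natSmul_X0_pow_mem q₀ c)

/-- Auxiliary step `X1_pow_mem` (§8): X1 pow mem. [bookkeeping] -/
theorem X1_pow_mem (q₀ : ℚ) {c : ℕ} (hc : c ≠ 0) : (X 1 ^ c : MvPolynomial (Fin 2) ℚ) ∈ Ex0 (hypQ q₀) :=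
  (Submodule.smul_mem_iff _ (Nat.cast_ne_zero.mpr hc)).mp (natSmul_X1_pow_mem q₀ c)

/-- `(xy)^i − (−q₀)^i` is a multiple of `q₀ + xy`. [folklore] -/
theorem exists_XX_pow_sub (q₀ : ℚ) (i : ℕ) :
    ∃ R : MvPolynomial (Fin 2) ℚ, (X 0 * X 1) ^ i - C ((-q₀) ^ i) = hypQ q₀ * R := by
  obtain ⟨R, hR⟩ := sub_dvd_pow_sub_pow (X 0 * X 1 : MvPolynomial (Fin 2) ℚ) (C (-q₀)) i
  refine ⟨R, ?_⟩
  rw [map_pow, hR, hypQ, map_neg]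
  ring

/-- Auxiliary step `XX_pow_sub_C_mem` (§8): XX pow sub C mem. [bookkeeping] -/
theorem XX_pow_sub_C_mem (q₀ : ℚ) (i : ℕ) :
    ((X 0 * X 1) ^ i - C ((-q₀) ^ i) : MvPolynomial (Fin 2) ℚ) ∈ Ex0 (hypQ q₀) := by
  obtain ⟨R, hR⟩ := exists_XX_pow_sub q₀ i
  rw [hR]
  exact mul_mem_ex0 _ _

/-- Off-diagonal monomials `x^{c} (xy)^j`, `c ≥ 1`, are exact. [folklore] -/
theorem X0_pow_mul_XX_pow_mem (q₀ : ℚ) {c : ℕ} (hc : c ≠ 0) (j : ℕ) :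
    (X 0 ^ c * (X 0 * X 1) ^ j : MvPolynomial (Fin 2) ℚ) ∈ Ex0 (hypQ q₀) := by
  obtain ⟨R, hR⟩ := exists_XX_pow_sub q₀ j
  have : (X 0 ^ c * (X 0 * X 1) ^ j : MvPolynomial (Fin 2) ℚ)
      = hypQ q₀ * (X 0 ^ c * R) + (-q₀) ^ j • X 0 ^ c := by
    rw [smul_eq_C_mul, mul_left_comm, ← hR]
    ring
  rw [this]
  exact add_mem (mul_mem_ex0 _ _) (Submodule.smul_mem _ _ (X0_pow_mem q₀ hc))

/-- Auxiliary step `X1_pow_mul_XX_pow_mem` (§8): X1 pow mul XX pow mem. [bookkeeping] -/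
theorem X1_pow_mul_XX_pow_mem (q₀ : ℚ) {c : ℕ} (hc : c ≠ 0) (j : ℕ) :
    (X 1 ^ c * (X 0 * X 1) ^ j : MvPolynomial (Fin 2) ℚ) ∈ Ex0 (hypQ q₀) := by
  obtain ⟨R, hR⟩ := exists_XX_pow_sub q₀ j
  have : (X 1 ^ c * (X 0 * X 1) ^ j : MvPolynomial (Fin 2) ℚ)
      = hypQ q₀ * (X 1 ^ c * R) + (-q₀) ^ j • X 1 ^ c := by
    rw [smul_eq_C_mul, mul_left_comm, ← hR]
    ring
  rw [this]
  exact add_mem (mul_mem_ex0 _ _) (Submodule.smul_mem _ _ (X1_pow_mem q₀ hc))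

/-- The summand of the alternating-diagonal functional. [folklore] -/
def diagFn (q₀ : ℚ) (d : Fin 2 →₀ ℕ) (a : ℚ) : ℚ := if d 0 = d 1 then a * (-q₀) ^ (d 0) else 0

/-- **The alternating-diagonal functional** `diagAlt_{q₀}(Σ p_ij x^i y^j) = Σ_i p_ii (−q₀)^i`
(the residue functional of `q₀ + xy`; for `q₀ = 1`: `Σ_i (−1)^i p_ii`). [folklore] -/
def diagAlt (q₀ : ℚ) (P : MvPolynomial (Fin 2) ℚ) : ℚ := (AddMonoidAlgebra.coeff P).sum (diagFn q₀)

/-- Auxiliary step `diagAlt_monomial` (§8): diag Alt monomial. [bookkeeping] -/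
theorem diagAlt_monomial (q₀ : ℚ) (d : Fin 2 →₀ ℕ) (a : ℚ) :
    diagAlt q₀ (monomial d a) = diagFn q₀ d a :=
  sum_monomial_eq (by simp [diagFn])

/-- Auxiliary step `diagAlt_add` (§8): diag Alt add. [bookkeeping] -/
theorem diagAlt_add (q₀ : ℚ) (P P' : MvPolynomial (Fin 2) ℚ) :
    diagAlt q₀ (P + P') = diagAlt q₀ P + diagAlt q₀ P' := by
  unfold diagAlt
  rw [AddMonoidAlgebra.coeff_add]
  exact Finsupp.sum_add_index' (fun d => by simp [diagFn]) (fun d b₁ b₂ => by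
    unfold diagFn; split_ifs <;> ring)

/-- Auxiliary step `diagAlt_C` (§8): diag Alt C. [bookkeeping] -/
theorem diagAlt_C (q₀ a : ℚ) : diagAlt q₀ (C a) = a := by
  rw [← monomial_zero', diagAlt_monomial]
  simp [diagFn]

/-- Auxiliary step `diagAlt_XX_pow` (§8): diag Alt XX pow. [bookkeeping] -/
theorem diagAlt_XX_pow (q₀ : ℚ) (i : ℕ) : diagAlt q₀ ((X 0 * X 1) ^ i) = (-q₀) ^ i := by
  have : ((X 0 * X 1) ^ i : MvPolynomial (Fin 2) ℚ) = monomial (Finsupp.single 0 i + Finsupp.single 1 i) 1 := by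
    rw [mul_pow, X_pow_eq_monomial, X_pow_eq_monomial, monomial_mul, one_mul]
  rw [this, diagAlt_monomial]
  simp [diagFn]

/-- Auxiliary step `diagAlt_smul` (§8): diag Alt smul. [bookkeeping] -/
theorem diagAlt_smul (q₀ c : ℚ) (P : MvPolynomial (Fin 2) ℚ) : diagAlt q₀ (c • P) = c * diagAlt q₀ P := by
  unfold diagAlt
  rw [AddMonoidAlgebra.coeff_smul, Finsupp.sum_smul_index' (fun d => by simp [diagFn]), Finsupp.mul_sum]
  apply Finsupp.sum_congr
  intro d _
  unfold diagFn
  split_ifs <;> simp [smul_eq_mul, mul_assoc]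

/-- Auxiliary step `diagAlt_C_mul` (§8): diag Alt C mul. [bookkeeping] -/
theorem diagAlt_C_mul (q₀ a : ℚ) (P : MvPolynomial (Fin 2) ℚ) : diagAlt q₀ (C a * P) = a * diagAlt q₀ P := by
  rw [← smul_eq_C_mul, diagAlt_smul]

/-- Auxiliary step `diagAlt_neg` (§8): diag Alt neg. [bookkeeping] -/
theorem diagAlt_neg (q₀ : ℚ) (P : MvPolynomial (Fin 2) ℚ) : diagAlt q₀ (-P) = -diagAlt q₀ P := by
  rw [← neg_one_smul ℚ P, diagAlt_smul, neg_one_mul]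

/-- Auxiliary step `diagAlt_sub` (§8): diag Alt sub. [bookkeeping] -/
theorem diagAlt_sub (q₀ : ℚ) (P P' : MvPolynomial (Fin 2) ℚ) :
    diagAlt q₀ (P - P') = diagAlt q₀ P - diagAlt q₀ P' := by
  rw [sub_eq_add_neg, diagAlt_add, diagAlt_neg, ← sub_eq_add_neg]

/-- Auxiliary step `diagAlt_X` (§8): diag Alt X. [bookkeeping] -/
theorem diagAlt_X (q₀ : ℚ) (k : Fin 2) : diagAlt q₀ (X k) = 0 := by
  show diagAlt q₀ (monomial (Finsupp.single k 1) 1) = 0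
  rw [diagAlt_monomial]
  fin_cases k <;> simp [diagFn]

/-- Auxiliary step `diagAlt_XX` (§8): diag Alt XX. [bookkeeping] -/
theorem diagAlt_XX (q₀ : ℚ) : diagAlt q₀ (X 0 * X 1) = -q₀ := by
  simpa using diagAlt_XX_pow q₀ 1

/-- Off-diagonal monomials have functional `0`. [folklore] -/
theorem diagAlt_X0_pow_mul_XX_pow (q₀ : ℚ) {c : ℕ} (hc : c ≠ 0) (j : ℕ) :
    diagAlt q₀ (X 0 ^ c * (X 0 * X 1) ^ j) = 0 := by
  have : (X 0 ^ c * (X 0 * X 1) ^ j : MvPolynomial (Fin 2) ℚ)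
      = monomial (Finsupp.single 0 (c + j) + Finsupp.single 1 j) 1 := by
    rw [mul_pow, ← mul_assoc, ← pow_add, X_pow_eq_monomial, X_pow_eq_monomial, monomial_mul, one_mul]
  rw [this, diagAlt_monomial]
  simp [diagFn, hc]

/-- Worked example (`q₀ = 1`): `P = x − y + 3xy + 3x²y²` has alternating diagonal sum `0 − 3 + 3 = 0`,
so `[ [0,1]², P/(1+xy) ]` falls under `hyperbola_two_mem_relations`. [folklore] -/
example : diagAlt 1 (X 0 - X 1 + C 3 * (X 0 * X 1) + C 3 * (X 0 * X 1) ^ 2) = 0 := by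
  rw [diagAlt_add, diagAlt_add, diagAlt_sub, diagAlt_X, diagAlt_X, diagAlt_C_mul, diagAlt_C_mul, diagAlt_XX,
    diagAlt_XX_pow]
  norm_num

/-- … while `P = 1` has functional `1 ≠ 0` (`∫∫ dxdy/(1+xy) = π²/12`, the non-exact generator). [folklore] -/
example : diagAlt 1 (C 1) = 1 := diagAlt_C 1 1

/-- **Every numerator is congruent to its functional modulo exact ones**: `P − diagAlt(P)·1 ∈ Ex0 (q₀ + xy)`. [folklore] -/
theorem sub_C_diagAlt_mem (q₀ : ℚ) (P : MvPolynomial (Fin 2) ℚ) :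
    P - C (diagAlt q₀ P) ∈ Ex0 (hypQ q₀) := by
  induction P using MvPolynomial.induction_on' with
  | monomial d a =>
    rw [diagAlt_monomial]
    have hmon : (monomial d a : MvPolynomial (Fin 2) ℚ) = a • (X 0 ^ (d 0) * X 1 ^ (d 1)) := by
      rw [monomial_eq, Finsupp.prod_pow, Fin.prod_univ_two, smul_eq_C_mul]
    rcases lt_trichotomy (d 0) (d 1) with hlt | heq | hgt
    · have hne : d 0 ≠ d 1 := ne_of_lt hlt
      simp only [diagFn, if_neg hne, map_zero, sub_zero, hmon]
      obtain ⟨e, he⟩ := Nat.exists_eq_add_of_lt hlt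
      have : (X 0 ^ (d 0) * X 1 ^ (d 1) : MvPolynomial (Fin 2) ℚ) = X 1 ^ (e + 1) * (X 0 * X 1) ^ (d 0) := by
        rw [he]; ring
      rw [this]
      exact Submodule.smul_mem _ _ (X1_pow_mul_XX_pow_mem q₀ (Nat.succ_ne_zero e) _)
    · have hval : diagFn q₀ d a = a * (-q₀) ^ (d 1) := by simp [diagFn, heq]
      have key : (a • (X 0 ^ (d 1) * X 1 ^ (d 1)) - C (a * (-q₀) ^ (d 1)) : MvPolynomial (Fin 2) ℚ)
          = a • ((X 0 * X 1) ^ (d 1) - C ((-q₀) ^ (d 1))) := by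
        rw [smul_eq_C_mul, smul_eq_C_mul, map_mul]
        ring
      rw [hval, hmon, heq, key]
      exact Submodule.smul_mem _ _ (XX_pow_sub_C_mem q₀ _)
    · have hne : d 0 ≠ d 1 := ne_of_gt hgt
      simp only [diagFn, if_neg hne, map_zero, sub_zero, hmon]
      obtain ⟨e, he⟩ := Nat.exists_eq_add_of_lt hgt
      have : (X 0 ^ (d 0) * X 1 ^ (d 1) : MvPolynomial (Fin 2) ℚ) = X 0 ^ (e + 1) * (X 0 * X 1) ^ (d 1) := by
        rw [he]; ring
      rw [this]
      exact Submodule.smul_mem _ _ (X0_pow_mul_XX_pow_mem q₀ (Nat.succ_ne_zero e) _)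
  | add p q hp hq =>
    have : p + q - C (diagAlt q₀ (p + q)) = (p - C (diagAlt q₀ p)) + (q - C (diagAlt q₀ q)) := by
      rw [diagAlt_add, map_add]; ring
    rw [this]
    exact add_mem hp hq

/-- **Numerators with vanishing alternating-diagonal functional are exact over `q₀ + xy`.** [folklore] -/
theorem drExact_hyperbola (q₀ : ℚ) (P : MvPolynomial (Fin 2) ℚ) (h : diagAlt q₀ P = 0) :
    DRExact P (C q₀ + X 0 * X 1) := by
  have := sub_C_diagAlt_mem q₀ P
  rw [h, map_zero, sub_zero] at this
  exact drExact_of_ex0 this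

/-- **DECIDED (m = 2, PROVED, N = 0): hyperbola denominators, alternating-diagonal-zero numerators.**
`[ [0,1]², P/(q₀ + xy) ]` with `Σ_i p_ii (−q₀)^i = 0`, zero-free, value `0` ⟹ `∈ relations`; for `q₀ = 1`
(`1 + xy`, the `ζ(2)` denominator) the condition is `Σ_i (−1)^i p_ii = 0`. [cite: KontsevichZagier2001, §1.2] -/
theorem hyperbola_two_mem_relations (q₀ : ℚ) (q : IntegralRep 2) (P : MvPolynomial (Fin 2) ℚ)
    (hP : diagAlt q₀ P = 0)
    (hd : q.domain = Set.pi Set.univ (fun _ : Fin 2 => Set.Icc (0:ℝ) 1))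
    (hQ : ∀ z ∈ Set.pi Set.univ (fun _ : Fin 2 => Set.Icc (0:ℝ) 1),
      MvPolynomial.aeval z (C q₀ + X 0 * X 1 : MvPolynomial (Fin 2) ℚ) ≠ 0)
    (hf : ∀ z ∈ Set.pi Set.univ (fun _ : Fin 2 => Set.Icc (0:ℝ) 1),
      q.integrand z = MvPolynomial.aeval z P / MvPolynomial.aeval z (C q₀ + X 0 * X 1 : MvPolynomial (Fin 2) ℚ))
    (h0 : q.value = 0) : of q ∈ relations := by
  obtain ⟨s, G, hid⟩ := drExact_hyperbola q₀ P hP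
  exact mem_relations_of_exact_two q P _ s G hid hd hQ hf h0

/-- The residual of 26322 on `q₀ + xy`: numerators with NON-ZERO alternating-diagonal functional (one parameter;
value `= diagAlt·∫∫dxdy/(q₀+xy) +` weight ≤ 1, e.g. `π²/12` for `q₀ = 1`, `P = 1`). [folklore] -/
def HyperbolaResidual (q₀ : ℚ) : Prop :=
  ∀ (q : IntegralRep 2) (P : MvPolynomial (Fin 2) ℚ), diagAlt q₀ P ≠ 0 →
    q.domain = Set.pi Set.univ (fun _ : Fin 2 => Set.Icc (0:ℝ) 1) →
    (∀ z ∈ Set.pi Set.univ (fun _ : Fin 2 => Set.Icc (0:ℝ) 1),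
      MvPolynomial.aeval z (C q₀ + X 0 * X 1 : MvPolynomial (Fin 2) ℚ) ≠ 0) →
    (∀ z ∈ Set.pi Set.univ (fun _ : Fin 2 => Set.Icc (0:ℝ) 1),
      q.integrand z = MvPolynomial.aeval z P / MvPolynomial.aeval z (C q₀ + X 0 * X 1 : MvPolynomial (Fin 2) ℚ)) →
    q.value = 0 → ∃ N : ℕ, (fun y : FormalRep => of piRep * y)^[N] (of q) ∈ relations

/-- **26322 on a hyperbola denominator ⟸ its one-parameter residual (PROVED split).** [folklore] -/
theorem hyperbola_single_of_residual (q₀ : ℚ) (h : HyperbolaResidual q₀) (q : IntegralRep 2)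
    (P : MvPolynomial (Fin 2) ℚ)
    (hd : q.domain = Set.pi Set.univ (fun _ : Fin 2 => Set.Icc (0:ℝ) 1))
    (hQ : ∀ z ∈ Set.pi Set.univ (fun _ : Fin 2 => Set.Icc (0:ℝ) 1),
      MvPolynomial.aeval z (C q₀ + X 0 * X 1 : MvPolynomial (Fin 2) ℚ) ≠ 0)
    (hf : ∀ z ∈ Set.pi Set.univ (fun _ : Fin 2 => Set.Icc (0:ℝ) 1),
      q.integrand z = MvPolynomial.aeval z P / MvPolynomial.aeval z (C q₀ + X 0 * X 1 : MvPolynomial (Fin 2) ℚ))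
    (h0 : q.value = 0) : ∃ N : ℕ, (fun y : FormalRep => of piRep * y)^[N] (of q) ∈ relations := by
  by_cases hP : diagAlt q₀ P = 0
  · exact ⟨0, by simpa using hyperbola_two_mem_relations q₀ q P hP hd hQ hf h0⟩
  · exact h q P hP hd hQ hf h0

/-! ## §9 (v5) FERMAT–HYPERBOLIC denominators `Q = q₀ + x₀x₁⋯x_n` in EVERY dimension — the `η(m)`/`ζ(m)` generators

`U_Q = 𝔸^{n+1} ∖ {x₀⋯x_n = −q₀}`, `Z ≅ 𝔾_m^n`, `H^{n+1}_dR(U_Q) ≅ H^n(𝔾_m^n) = ℚ`, functional = iterated residue / constant term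
`diagAltm q₀ P = Σ_i p_{i,i,…,i} (−q₀)^i` (pure-diagonal coefficients). Generator `1/(1 + x₀⋯x_n)` with
`∫_{[0,1]^{n+1}} = Σ_k (−1)^k/(k+1)^{n+1} = η(n+1) = (1 − 2^{−n}) ζ(n+1)`: `π²/12` (n = 1), `(3/4)ζ(3)` (n = 2), … .
CONSTRUCTIVE HALF (kernel-checked, uniform in n): a monomial `x^d` with NON-CONSTANT exponent vector `d` is `s = 0`-exact —
potentials `G_j = α_j x_j x^d` with `Σ_j α_j = 0`, `Σ_j α_j d_j = 1` (Euler: `x_j∂_j x^d = d_j x^d`, `x_j ∂_j(x₀⋯x_n) = x₀⋯x_n`), e.g.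
`α = (e_k − e_l)/(d_k − d_l)`; and `u^i − (−q₀)^i ∈ Q·ℚ[x]` (`u = x₀⋯x_n`). Hence `P − C(diagAltm q₀ P) ∈ Ex0m Q` for every `P`,
`diagAltm q₀ P = 0 ⟹ DRExact P Q`, and through v2: dimension `n+1` instances with vanishing functional REDUCE to `SingleAt n`;
DECIDED at m = 2 (N = 0; = §8 by a second route) and at m = 3 GIVEN `DimTwoRationalStratum` (the `ζ(3)` denominator `1 + xyz`:
numerators with `Σ_k p_kkk (−1)^k = 0`). -/

section FermatHyperbolic

variable {n : ℕ}

/-- `s = 0`-exact numerators over `Q`, any dimension. [folklore] -/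
def Ex0m (Q : MvPolynomial (Fin n) ℚ) : Submodule ℚ (MvPolynomial (Fin n) ℚ) where
  carrier := {P | ∃ G : Fin n → MvPolynomial (Fin n) ℚ, P * Q = ∑ k, exS Q k (G k)}
  zero_mem' := ⟨0, by simp [exS_zero]⟩
  add_mem' := by
    rintro a b ⟨G, hG⟩ ⟨G', hG'⟩
    refine ⟨G + G', ?_⟩
    rw [add_mul, hG, hG', ← Finset.sum_add_distrib]
    simp only [Pi.add_apply, exS_add]
  smul_mem' := by
    rintro c a ⟨G, hG⟩
    refine ⟨c • G, ?_⟩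
    rw [smul_mul_assoc, hG, Finset.smul_sum]
    simp only [Pi.smul_apply, exS_smul]

end FermatHyperbolic
end Summit.KontsevichZagierPeriods.RootDecompRationalCubeDichotomy.Rung26322.RankDescent
end
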